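import Summits.CriticalPhenomena.PercolationContinuityZ3.Theorems.PercNearOneGluingNoHeavyLowerTailCILUnionExchange
import HarnessLib

/-!
# `NoHeavyLowerTail` (stmt-CriticalPhenomena-4575) — the averaged post-FKG / selection inequality for TWO candidates
# and an ARBITRARY increasing cluster target

Hull-port prover #4 (prim-hp-4 gen 7, LP-duality line), 2026-08-19.  `μ = prodBernoulli w` on a finite vertex type,
observer `o`, candidates `a₁ ≠ a₂`, and an arbitrary upper family `𝒜` of edge sets read on the open edge clusters
(`C_s ∈ 𝒜` is an increasing "target" event: `s ↔ b`, `|π(s)| > j`, `s ↔ b ∨ s ↔ b'`, …).  Label the candidates so that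
`a₁` is the LESS promising one, `μ{C_{a₁} ∈ 𝒜} ≤ μ{C_{a₂} ∈ 𝒜}`, and let `W` be the first of `(a₁, a₂)` joined to `o`.  Then

  **`μ(o ↔ a₁)·μ{C_{a₁} ∈ 𝒜} + μ(o ↔ a₂, o ↮ a₁)·μ{C_{a₂} ∈ 𝒜} ≤ μ(o ↔ {a₁,a₂}, C_o ∈ 𝒜)`**   (`averagedPostFKG_pair_family`),

i.e. `E[μ{C_W ∈ 𝒜}; o ↔ {a₁,a₂}] ≤ μ(C_W ∈ 𝒜, o ↔ {a₁,a₂})`: selecting the least promising reached candidate does not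
deflate its target probability.  This is the two-candidate case of ONE selection principle (SEL-𝒯) of which the cell's
AVG_m (target `∋ b`; ⟹ Kozma–Nitzan Conj. 1), the selection inequality (SO_ρ) of the hull-port line (target
`∋ a₁ ∨ > j relays`) and the PL-block bound `stub_blockLightest` (target `> j relays`) are instances (memo
HULLPORT-LP-gen7.md §4; census: all 166 up-set targets on 4 points, 0 violations).  gen 5 proved the case `𝒜 = {C ∋ b}`
(`SelectionOrder.averagedPostFKG_pair`); the general case is the same thirty lines on top of prim-gen-induct's
`UnionExchange.pair_clusterDominance` (Kozma–Nitzan's (6) for an arbitrary functional).  No definitions, no sorries.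
-/

noncomputable section

namespace Summit.CriticalPhenomena.PercolationContinuityZ3.Theorems

open MeasureTheory Set Literature.Probability.LatticeModels Literature.Probability.Percolation
open scoped Classical

namespace SelectionOrder

variable {V : Type*} [Fintype V]

open UnionExchange in
/-- **Averaged post-FKG / two-candidate selection inequality for an arbitrary increasing cluster target.**  For
`a₁ ≠ a₂`, an upper family `𝒜`, and `μ{C_{a₁} ∈ 𝒜} ≤ μ{C_{a₂} ∈ 𝒜}`:
`μ(o↔a₁)·μ{C_{a₁}∈𝒜} + μ(o↔a₂, o↮a₁)·μ{C_{a₂}∈𝒜} ≤ μ((o↔a₁ ∪ o↔a₂) ∩ {C_o ∈ 𝒜})`.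
[cite: KozmaNitzan2024, Thm. 1 (pp. 7–8), inequality (6); VandenbergHaggstromKahn2005, Thms. 1.3–1.4; this work] -/
theorem averagedPostFKG_pair_family (w : Sym2 V → unitInterval) (o a₁ a₂ : V) (h12 : a₁ ≠ a₂)
    {𝒜 : Set (Set (Sym2 V))} (h𝒜 : IsUpperSet 𝒜)
    (hp : (prodBernoulli w).real {ω : BondConfig V | openEdgeCluster ω a₁ ∈ 𝒜} ≤
      (prodBernoulli w).real {ω : BondConfig V | openEdgeCluster ω a₂ ∈ 𝒜}) :
    (prodBernoulli w).real (openConn o a₁) * (prodBernoulli w).real {ω : BondConfig V | openEdgeCluster ω a₁ ∈ 𝒜} +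
        (prodBernoulli w).real (openConn o a₂ ∩ (openConn o a₁)ᶜ) *
          (prodBernoulli w).real {ω : BondConfig V | openEdgeCluster ω a₂ ∈ 𝒜} ≤
      (prodBernoulli w).real ((openConn o a₁ ∪ openConn o a₂) ∩ {ω : BondConfig V | openEdgeCluster ω o ∈ 𝒜}) := by
  set μ := prodBernoulli w with hμ
  set O₁ : Set (BondConfig V) := openConn o a₁ with hO₁
  set O₂ : Set (BondConfig V) := openConn o a₂ with hO₂
  set A₀ : Set (BondConfig V) := {ω | openEdgeCluster ω o ∈ 𝒜} with hA₀
  set A₁ : Set (BondConfig V) := {ω | openEdgeCluster ω a₁ ∈ 𝒜} with hA₁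
  set A₂ : Set (BondConfig V) := {ω | openEdgeCluster ω a₂ ∈ 𝒜} with hA₂
  set D : Set (BondConfig V) := {ω | ¬ (openGraph ω).Reachable a₁ a₂} with hD
  have hdom := pair_clusterDominance w o a₁ a₂ h12 h𝒜
  simp only [← hO₁, ← hO₂, ← hA₀, ← hA₁, ← hA₂, ← hD, ← hμ] at hdom
  -- bookkeeping: `O₂ \ O₁ = D ∩ O₂`, `μ(U) = μ(O₁) + μ(D ∩ O₂) ≥ φ₁ + φ₂`
  have hO2c : O₂ ∩ O₁ᶜ = D ∩ O₂ := by
    ext ω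
    simp only [mem_inter_iff, mem_compl_iff, hO₁, hO₂, hD, openConn, mem_setOf_eq]
    constructor
    · rintro ⟨h2, hn1⟩
      exact ⟨fun h => hn1 (h2.trans h.symm), h2⟩
    · rintro ⟨hn, h2⟩
      exact ⟨h2, fun h1 => hn (h1.symm.trans h2)⟩
  have hsplit : ∀ S T : Set (BondConfig V), μ.real S = μ.real (S ∩ T) + μ.real (S ∩ Tᶜ) := by
    intro S T
    rw [← measureReal_inter_add_sdiff (s := S) (MeasurableSet.of_discrete : MeasurableSet T), Set.sdiff_eq]
  have hPA : μ.real (O₁ ∪ O₂) = μ.real O₁ + μ.real (D ∩ O₂) := by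
    rw [hsplit (O₁ ∪ O₂) O₁, ← hO2c]
    congr 1
    · rw [union_inter_cancel_left]
    · congr 1
      ext ω
      simp only [mem_inter_iff, mem_union, mem_compl_iff]
      tauto
  have hφ1le : μ.real (D ∩ O₁) ≤ μ.real O₁ := measureReal_mono inter_subset_right
  have hS_le : μ.real (D ∩ O₁) + μ.real (D ∩ O₂) ≤ μ.real (O₁ ∪ O₂) := by rw [hPA]; linarith
  have hφ1 : 0 ≤ μ.real (D ∩ O₁) := measureReal_nonneg
  have hφ2 : 0 ≤ μ.real (D ∩ O₂) := measureReal_nonneg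
  have hp1 : 0 ≤ μ.real A₁ := measureReal_nonneg
  -- the degenerate case uses Harris for `O₁` and `A₁` and `O₁ ∩ A₁ ⊆ U ∩ A₀`
  have hEsub : μ.real (O₁ ∩ A₁) ≤ μ.real ((O₁ ∪ O₂) ∩ A₀) := by
    refine measureReal_mono ?_
    rintro ω ⟨h1, hA⟩
    refine ⟨Or.inl h1, ?_⟩
    simp only [hA₀, hA₁, mem_setOf_eq] at hA ⊢
    rwa [← openEdgeCluster_eq_of_reachable (h1 : (openGraph ω).Reachable o a₁)]
  have hHO1 : μ.real O₁ * μ.real A₁ ≤ μ.real (O₁ ∩ A₁) :=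
    prodBernoulli_harris w (isUpperSet_openConn o a₁) (isUpperSet_setOf_openEdgeCluster_mem a₁ h𝒜)
      MeasurableSet.of_discrete MeasurableSet.of_discrete
  rw [hO2c]
  by_cases hS : μ.real (D ∩ O₁) + μ.real (D ∩ O₂) = 0
  · have hφ2z : μ.real (D ∩ O₂) = 0 := by linarith
    rw [hφ2z, zero_mul, add_zero]
    exact hHO1.trans hEsub
  · have hSpos : 0 < μ.real (D ∩ O₁) + μ.real (D ∩ O₂) := lt_of_le_of_ne (by linarith) (Ne.symm hS)
    have hdp : 0 ≤ μ.real A₂ - μ.real A₁ := by linarith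
    -- `S·E ≥ u(φ₁p₁ + φ₂p₂) ≥ S(u p₁ + φ₂(p₂ - p₁))` with `u = μ(U) ≥ S`
    have key : (μ.real (D ∩ O₁) + μ.real (D ∩ O₂)) * μ.real ((O₁ ∪ O₂) ∩ A₀) ≥
        (μ.real (D ∩ O₁) + μ.real (D ∩ O₂)) * (μ.real O₁ * μ.real A₁ + μ.real (D ∩ O₂) * μ.real A₂) := by
      have t2 : μ.real (D ∩ O₁) * μ.real A₁ + μ.real (D ∩ O₂) * μ.real A₂ =
          (μ.real (D ∩ O₁) + μ.real (D ∩ O₂)) * μ.real A₁ + μ.real (D ∩ O₂) * (μ.real A₂ - μ.real A₁) := by ring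
      have t3 : μ.real (O₁ ∪ O₂) * (μ.real (D ∩ O₂) * (μ.real A₂ - μ.real A₁)) ≥
          (μ.real (D ∩ O₁) + μ.real (D ∩ O₂)) * (μ.real (D ∩ O₂) * (μ.real A₂ - μ.real A₁)) :=
        mul_le_mul_of_nonneg_right hS_le (mul_nonneg hφ2 hdp)
      have t4 : (μ.real (D ∩ O₁) + μ.real (D ∩ O₂)) * (μ.real O₁ * μ.real A₁ + μ.real (D ∩ O₂) * μ.real A₂) =
          (μ.real (D ∩ O₁) + μ.real (D ∩ O₂)) * (μ.real (O₁ ∪ O₂) * μ.real A₁) +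
            (μ.real (D ∩ O₁) + μ.real (D ∩ O₂)) * (μ.real (D ∩ O₂) * (μ.real A₂ - μ.real A₁)) := by
        rw [hPA]; ring
      nlinarith [hdom, t2, t3, t4, measureReal_nonneg (μ := μ) (s := O₁ ∪ O₂)]
    exact le_of_mul_le_mul_left (by linarith [key]) hSpos

end SelectionOrder

end Summit.CriticalPhenomena.PercolationContinuityZ3.Theorems

end
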